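import Summits.Ventures.Crystal3D.Theorems.StickyWulffConstantCoaxialWallLawReaderRigidity
import Summits.Ventures.Crystal3D.Theorems.StickyWulffConstantCoaxialWallLawWordMoves
import Summits.Ventures.Crystal3D.Theorems.StickyWulffConstantCoaxialWallLawTerracePropagation
import HarnessLib

/-!
# Same-ball twin-reading RIGIDITY: one ball is a twin reading of at most one plane, in at most two (mirror) frames
# (lane T, crux `TextureLiminfV5`, stmt-Ventures-23912, registered stub `stub_terraceCensus`; (β) terrace census, LevelReach — the relaunch letter)

HONEST FRAMING. Venture `Summits/Ventures/Crystal3D` (cell `crystal3d-full`), route `route-Ventures-StickyWulffConstant`, helper `--supports`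
the law-v5 crux `TextureLiminfV5` (stmt-Ventures-23912), lane T, mechanism (β) (launch census `word_family_endPairs_launch`,
…TexShadowLevelReach p739507; mirror launches …TexShadowLevelReachMirrorLaunch p740126).  Pure finite geometry of twin dozens in a `1`-separated
configuration (kissing number twelve via lane F's `contacts_eq_of_isTwinReading`); census-free, certificate-free; nothing about energies; F-C1 not moved.

THE POINT.  In the launch census the only way a launched line can be RELAUNCHED INTO (its launch ball `p = r + A′w` stepped onto by another walk
arriving in the root class) is a cancelling-pair CROSS at the reading `r`: a walk in a one-letter class `[μ]` reads `IsTwinReading X (F [μ]) (F [] μ) r`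
and pops to `[]`.  For MIRROR launches `r` is itself a twin reading of `(A, n)`.  This file shows that a ball carries at most ONE twin-reading plane:
* `isTwinReading_transfer` — `IsTwinReading` depends on the frame only through its slot dozen;
* `isTwinReading_mirrorFrame` — a twin reading of `(A, n)` at `r` is a twin reading of `(A′, −n)`, `A′ = A − 2⟪A·, n⟫ n` (far slots of `A′` empty by
  `twinDozen_mirror_pos_notMem`, `1`-separation only);
* **`isTwinReading_rigid`** — if `r` is a twin reading of `(A, n)` AND of `(G, m)`, then EITHER `G` has `A`'s slot dozen and `m = n`, OR `G` has `A′`'s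
  slot dozen and `m = −n`.  Proof: the lower `G`-cap of `m` is a contact triangle of `r`; by lane F's `twin_contact_trichotomy` each member lies on `A·Λ₀`
  (in-plane / negative) or on `A′·Λ₀` (in-plane / mirror), a negative and a mirror member never touch (`inner_ne_half_of_neg_of_mirror`), so the
  triangle lies on ONE lattice, three independent unit vectors pin `G·Λ₀` (`movedFcc_eq_of_three_independent_units`), and in a fixed frame the normal
  is unique (`twinDozen_normal_eq_self`);
* `isTwinReading_normal_eq_or` — hence `m = n ∨ m = −n`;
* **`relaunch_letter_eq`** — the RELAUNCH LETTER: if the root direction `F₀ w` crosses `n` upward (`⟪F₀ w, n⟫ = √(2/3)`), a letter `μ` with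
  `⟪w, μ⟫ = √(2/3)` (well-formedness of `[μ]`) whose class reads `(M_μ ≫ F₀, F₀ μ)` at a twin reading `r` of `(A, n)` is `μ = F₀⁻¹ n` — ONE class
  only can relaunch into a mirror launch; the census of the next file never enters it.
WHAT THIS IS NOT: any count; F-C1 not moved.
-/

noncomputable section

namespace Summit.Ventures.Crystal3D.Theorems

open Summit.Ventures.Crystal3D Finset
open Literature.MathematicalPhysics.StatisticalMechanics (fccStacking)
open scoped InnerProductSpace

variable {X : Finset (EuclideanSpace ℝ (Fin 3))}

/-! ## Transfer along equal slot dozens, and the mirror frame -/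

/-- A property of all slot images transfers between frames with the same slot dozen. -/
theorem forall_slot_transfer {G G' : EuclideanSpace ℝ (Fin 3) ≃ₗᵢ[ℝ] EuclideanSpace ℝ (Fin 3)}
    (hGG : (G : EuclideanSpace ℝ (Fin 3) → EuclideanSpace ℝ (Fin 3)) '' ↑fccSlots =
      (G' : EuclideanSpace ℝ (Fin 3) → EuclideanSpace ℝ (Fin 3)) '' ↑fccSlots)
    (P : EuclideanSpace ℝ (Fin 3) → Prop) (h : ∀ w ∈ fccSlots, P (G w)) : ∀ w ∈ fccSlots, P (G' w) := by
  intro w hw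
  have : G' w ∈ (G : EuclideanSpace ℝ (Fin 3) → EuclideanSpace ℝ (Fin 3)) '' ↑fccSlots := by
    rw [hGG]; exact Set.mem_image_of_mem _ (Finset.mem_coe.2 hw)
  obtain ⟨w₀, hw₀, e⟩ := this
  rw [← e]; exact h w₀ (Finset.mem_coe.1 hw₀)

/-- **`IsTwinReading` depends on the frame only through its slot dozen.** -/
theorem isTwinReading_transfer {G G' : EuclideanSpace ℝ (Fin 3) ≃ₗᵢ[ℝ] EuclideanSpace ℝ (Fin 3)}
    (hGG : (G : EuclideanSpace ℝ (Fin 3) → EuclideanSpace ℝ (Fin 3)) '' ↑fccSlots =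
      (G' : EuclideanSpace ℝ (Fin 3) → EuclideanSpace ℝ (Fin 3)) '' ↑fccSlots)
    {m b : EuclideanSpace ℝ (Fin 3)} (h : IsTwinReading X G m b) : IsTwinReading X G' m b := by
  obtain ⟨⟨hm, hmenu⟩, hown, hmir, hfar⟩ := h
  exact ⟨⟨hm, forall_slot_transfer hGG (fun x => ⟪x, m⟫_ℝ = 0 ∨ ⟪x, m⟫_ℝ = Real.sqrt (2 / 3) ∨ ⟪x, m⟫_ℝ = -Real.sqrt (2 / 3)) hmenu⟩,
    forall_slot_transfer hGG (fun x => ⟪x, m⟫_ℝ ≤ 0 → b + x ∈ X) hown,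
    forall_slot_transfer hGG (fun x => ⟪x, m⟫_ℝ < 0 → b + (x - (2 * ⟪x, m⟫_ℝ) • m) ∈ X) hmir,
    forall_slot_transfer hGG (fun x => 0 < ⟪x, m⟫_ℝ → b + x ∉ X) hfar⟩

/-- **A twin reading of `(A, n)` is a twin reading of the mirror frame `(A′, −n)`**, `A′ x = A x − 2⟪A x, n⟫ n`: the own nine of `(A′, −n)` are the
in-plane hexagon and the three mirror balls, its mirror balls are the own lower cap, and its far slots are empty (`twinDozen_mirror_pos_notMem`). -/
theorem isTwinReading_mirrorFrame (hX : ∀ p ∈ X, ∀ q ∈ X, p ≠ q → 1 ≤ dist p q)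
    (A A' : EuclideanSpace ℝ (Fin 3) ≃ₗᵢ[ℝ] EuclideanSpace ℝ (Fin 3)) {n r : EuclideanSpace ℝ (Fin 3)}
    (hA' : ∀ x, A' x = A x - (2 * ⟪A x, n⟫_ℝ) • n) (h : IsTwinReading X A n r) : IsTwinReading X A' (-n) r := by
  obtain ⟨⟨hn, hmenu⟩, hown, hmir, -⟩ := h
  have nn : ⟪n, n⟫_ℝ = 1 := by rw [real_inner_self_eq_norm_sq, hn, one_pow]
  have hval : ∀ x, ⟪A' x, -n⟫_ℝ = ⟪A x, n⟫_ℝ := by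
    intro x; rw [hA' x, inner_neg_right, inner_sub_left, real_inner_smul_left, nn]; ring
  refine ⟨⟨by rw [norm_neg, hn], fun w hw => by rw [hval]; exact hmenu w hw⟩, ?_, ?_, ?_⟩
  · intro w hw hle
    rw [hval] at hle
    rcases hle.lt_or_eq with hlt | h0
    · rw [hA' w]; exact hmir w hw hlt
    · rw [hA' w, h0, mul_zero, zero_smul, sub_zero]; exact hown w hw hle
  · intro w hw hlt
    rw [hval] at hlt
    have e : r + (A' w - (2 * ⟪A' w, -n⟫_ℝ) • (-n)) = r + A w := by
      rw [hval, hA' w, smul_neg, sub_neg_eq_add, sub_add_cancel]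
    rw [e]; exact hown w hw hlt.le
  · intro w hw hpos
    rw [hval] at hpos
    rw [hA' w]
    exact twinDozen_mirror_pos_notMem hX A hn hmenu hown hw hpos

/-! ## The rigidity theorem -/

/-- **SAME-BALL TWIN-READING RIGIDITY.**  In a `1`-separated `X`, if `r` is a twin reading of `(A, n)` and of `(G, m)`, then either `G` has the slot
dozen of `A` and `m = n`, or `G` has the slot dozen of the mirror frame `A′ = A ≫ R_n` and `m = −n`. -/
theorem isTwinReading_rigid (hX : ∀ p ∈ X, ∀ q ∈ X, p ≠ q → 1 ≤ dist p q)
    (A G : EuclideanSpace ℝ (Fin 3) ≃ₗᵢ[ℝ] EuclideanSpace ℝ (Fin 3)) {n m r : EuclideanSpace ℝ (Fin 3)}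
    (hA : IsTwinReading X A n r) (hG : IsTwinReading X G m r) :
    ((G : EuclideanSpace ℝ (Fin 3) → EuclideanSpace ℝ (Fin 3)) '' ↑fccSlots =
        (A : EuclideanSpace ℝ (Fin 3) → EuclideanSpace ℝ (Fin 3)) '' ↑fccSlots ∧ m = n) ∨
    ((G : EuclideanSpace ℝ (Fin 3) → EuclideanSpace ℝ (Fin 3)) '' ↑fccSlots =
        ((A.trans (ℝ ∙ n)ᗮ.reflection : EuclideanSpace ℝ (Fin 3) ≃ₗᵢ[ℝ] EuclideanSpace ℝ (Fin 3)) :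
          EuclideanSpace ℝ (Fin 3) → EuclideanSpace ℝ (Fin 3)) '' ↑fccSlots ∧ m = -n) := by
  have hr : 0 < Real.sqrt (2 / 3) := Real.sqrt_pos.2 (by norm_num)
  set A' : EuclideanSpace ℝ (Fin 3) ≃ₗᵢ[ℝ] EuclideanSpace ℝ (Fin 3) := A.trans (ℝ ∙ n)ᗮ.reflection with hA'def
  have hn1 : ‖n‖ = 1 := hA.1.1
  have hA' : ∀ x, A' x = A x - (2 * ⟪A x, n⟫_ℝ) • n := fun x => by
    rw [hA'def, LinearIsometryEquiv.trans_apply, reflection_unit_apply hn1]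
  have hA'read : IsTwinReading X A' (-n) r := isTwinReading_mirrorFrame hX A A' hA' hA
  -- the lower `G`-cap of `m`: three slots reading `−√(2/3)`, pairwise at `60°`, independent
  have hm1 : ‖m‖ = 1 := hG.1.1
  have hm1' : ‖-m‖ = 1 := by rw [norm_neg, hm1]
  have hmenu' : ∀ w ∈ fccSlots, ⟪G w, -m⟫_ℝ = 0 ∨ ⟪G w, -m⟫_ℝ = Real.sqrt (2 / 3) ∨ ⟪G w, -m⟫_ℝ = -Real.sqrt (2 / 3) := by
    intro w hw
    rw [inner_neg_right]
    rcases hG.1.2 w hw with h0 | h0 | h0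
    · exact Or.inl (by rw [h0, neg_zero])
    · exact Or.inr (Or.inr (by rw [h0]))
    · exact Or.inr (Or.inl (by rw [h0, neg_neg]))
  obtain ⟨v₁, hv₁, v₂, hv₂, v₃, hv₃, hn₁, hn₂, hn₃, i12, i13, i23, hind, -⟩ := exists_far_frame G hm1' hmenu'
  have neg : ∀ {v}, ⟪G v, -m⟫_ℝ = Real.sqrt (2 / 3) → ⟪G v, m⟫_ℝ < 0 := by
    intro v hv; rw [inner_neg_right] at hv; linarith
  have hc₁ : r + G v₁ ∈ X := hG.2.1 v₁ hv₁ (neg hn₁).le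
  have hc₂ : r + G v₂ ∈ X := hG.2.1 v₂ hv₂ (neg hn₂).le
  have hc₃ : r + G v₃ ∈ X := hG.2.1 v₃ hv₃ (neg hn₃).le
  have nG : ∀ {v}, v ∈ fccSlots → ‖G v‖ = 1 := fun hv => by rw [LinearIsometryEquiv.norm_map, norm_eq_one_of_mem_fccSlots hv]
  -- each cap member is on `A·Λ₀` (in-plane / negative) or on `A′·Λ₀` (in-plane / mirror)
  have t₁ := twin_contact_trichotomy hX hA (nG hv₁) hc₁
  have t₂ := twin_contact_trichotomy hX hA (nG hv₂) hc₂
  have t₃ := twin_contact_trichotomy hX hA (nG hv₃) hc₃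
  -- a negative member and a mirror member never touch
  have hnm : ∀ {v v' : EuclideanSpace ℝ (Fin 3)}, ⟪v, v'⟫_ℝ = 1 / 2 →
      (∃ w ∈ fccSlots, ⟪A w, n⟫_ℝ < 0 ∧ G v = A w) →
      (∃ w ∈ fccSlots, ⟪A w, n⟫_ℝ < 0 ∧ G v' = A w - (2 * ⟪A w, n⟫_ℝ) • n) → False := by
    intro v v' hvv ⟨w, hw, hneg, he⟩ ⟨w', hw', hneg', he'⟩
    have h1 : ⟪G v, G v'⟫_ℝ = 1 / 2 := by rw [LinearIsometryEquiv.inner_map_map, hvv]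
    rw [he, he'] at h1
    exact inner_ne_half_of_neg_of_mirror hA.1 hw hw' hneg hneg' h1
  have i21 : ⟪v₂, v₁⟫_ℝ = 1 / 2 := by rw [real_inner_comm]; exact i12
  have i31 : ⟪v₃, v₁⟫_ℝ = 1 / 2 := by rw [real_inner_comm]; exact i13
  have i32 : ⟪v₃, v₂⟫_ℝ = 1 / 2 := by rw [real_inner_comm]; exact i23
  -- the memberships in `G·Λ₀`
  have mG₁ : G v₁ ∈ G '' fccStacking 1 (Real.sqrt (2 / 3)) := ⟨v₁, mem_fcc_of_mem_fccSlots hv₁, rfl⟩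
  have mG₂ : G v₂ ∈ G '' fccStacking 1 (Real.sqrt (2 / 3)) := ⟨v₂, mem_fcc_of_mem_fccSlots hv₂, rfl⟩
  have mG₃ : G v₃ ∈ G '' fccStacking 1 (Real.sqrt (2 / 3)) := ⟨v₃, mem_fcc_of_mem_fccSlots hv₃, rfl⟩
  have hindG : LinearIndependent ℝ ![G v₁, G v₂, G v₃] := linearIndependent_map_triple G hind
  -- case split: all three on `A·Λ₀`, or all three on `A′·Λ₀`
  by_cases hall : G v₁ ∈ A '' fccStacking 1 (Real.sqrt (2 / 3)) ∧ G v₂ ∈ A '' fccStacking 1 (Real.sqrt (2 / 3)) ∧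
      G v₃ ∈ A '' fccStacking 1 (Real.sqrt (2 / 3))
  · -- `G·Λ₀ = A·Λ₀`, same dozen, same normal
    obtain ⟨m₁, m₂, m₃⟩ := hall
    have hΛ : G '' fccStacking 1 (Real.sqrt (2 / 3)) = A '' fccStacking 1 (Real.sqrt (2 / 3)) :=
      movedFcc_eq_of_three_independent_units G A mG₁ mG₂ mG₃ m₁ m₂ m₃ (nG hv₁) (nG hv₂) (nG hv₃) hindG
    have hdz := image_fccSlots_eq_of_image_fcc_eq G A hΛ
    have hAm : IsTwinReading X A m r := isTwinReading_transfer hdz hG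
    exact Or.inl ⟨hdz, (twinDozen_normal_eq_self A hn1 hm1 hA.1.2 hAm.1.2 hA.2.1 hAm.2.2.2).symm⟩
  · -- some member is off `A·Λ₀`: it is a mirror; then no member is negative; all are on `A′·Λ₀`
    have key : ∀ {v v' v'' : EuclideanSpace ℝ (Fin 3)},
        ⟪v', v⟫_ℝ = 1 / 2 → ⟪v'', v⟫_ℝ = 1 / 2 →
        ((G v ∈ A '' fccStacking 1 (Real.sqrt (2 / 3)) ∧ G v ∈ A' '' fccStacking 1 (Real.sqrt (2 / 3))) ∨
          (G v ∈ A '' fccStacking 1 (Real.sqrt (2 / 3)) ∧ ∃ w ∈ fccSlots, ⟪A w, n⟫_ℝ < 0 ∧ G v = A w) ∨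
          (G v ∈ A' '' fccStacking 1 (Real.sqrt (2 / 3)) ∧ ∃ w ∈ fccSlots, ⟪A w, n⟫_ℝ < 0 ∧ G v = A w - (2 * ⟪A w, n⟫_ℝ) • n)) →
        ((G v' ∈ A '' fccStacking 1 (Real.sqrt (2 / 3)) ∧ G v' ∈ A' '' fccStacking 1 (Real.sqrt (2 / 3))) ∨
          (G v' ∈ A '' fccStacking 1 (Real.sqrt (2 / 3)) ∧ ∃ w ∈ fccSlots, ⟪A w, n⟫_ℝ < 0 ∧ G v' = A w) ∨
          (G v' ∈ A' '' fccStacking 1 (Real.sqrt (2 / 3)) ∧ ∃ w ∈ fccSlots, ⟪A w, n⟫_ℝ < 0 ∧ G v' = A w - (2 * ⟪A w, n⟫_ℝ) • n)) →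
        ((G v'' ∈ A '' fccStacking 1 (Real.sqrt (2 / 3)) ∧ G v'' ∈ A' '' fccStacking 1 (Real.sqrt (2 / 3))) ∨
          (G v'' ∈ A '' fccStacking 1 (Real.sqrt (2 / 3)) ∧ ∃ w ∈ fccSlots, ⟪A w, n⟫_ℝ < 0 ∧ G v'' = A w) ∨
          (G v'' ∈ A' '' fccStacking 1 (Real.sqrt (2 / 3)) ∧ ∃ w ∈ fccSlots, ⟪A w, n⟫_ℝ < 0 ∧ G v'' = A w - (2 * ⟪A w, n⟫_ℝ) • n)) →
        G v ∉ A '' fccStacking 1 (Real.sqrt (2 / 3)) →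
        G v ∈ A' '' fccStacking 1 (Real.sqrt (2 / 3)) ∧ G v' ∈ A' '' fccStacking 1 (Real.sqrt (2 / 3)) ∧
          G v'' ∈ A' '' fccStacking 1 (Real.sqrt (2 / 3)) := by
      intro v v' v'' i1 i2 t t' t'' hv
      -- `v` is a mirror
      have hmirv : G v ∈ A' '' fccStacking 1 (Real.sqrt (2 / 3)) ∧
          ∃ w ∈ fccSlots, ⟪A w, n⟫_ℝ < 0 ∧ G v = A w - (2 * ⟪A w, n⟫_ℝ) • n := by
        rcases t with ⟨h1, -⟩ | ⟨h1, -⟩ | h3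
        · exact absurd h1 hv
        · exact absurd h1 hv
        · exact h3
      refine ⟨hmirv.1, ?_, ?_⟩
      · rcases t' with ⟨-, h2⟩ | ⟨-, hneg⟩ | ⟨h2, -⟩
        · exact h2
        · exact (hnm i1 hneg hmirv.2).elim
        · exact h2
      · rcases t'' with ⟨-, h2⟩ | ⟨-, hneg⟩ | ⟨h2, -⟩
        · exact h2
        · exact (hnm i2 hneg hmirv.2).elim
        · exact h2
    -- which member is off `A·Λ₀`?
    have hA'Λ : G v₁ ∈ A' '' fccStacking 1 (Real.sqrt (2 / 3)) ∧ G v₂ ∈ A' '' fccStacking 1 (Real.sqrt (2 / 3)) ∧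
        G v₃ ∈ A' '' fccStacking 1 (Real.sqrt (2 / 3)) := by
      by_cases h₁ : G v₁ ∈ A '' fccStacking 1 (Real.sqrt (2 / 3))
      · by_cases h₂ : G v₂ ∈ A '' fccStacking 1 (Real.sqrt (2 / 3))
        · have h₃ : G v₃ ∉ A '' fccStacking 1 (Real.sqrt (2 / 3)) := fun h₃ => hall ⟨h₁, h₂, h₃⟩
          obtain ⟨a, b, c⟩ := key i13 i23 t₃ t₁ t₂ h₃
          exact ⟨b, c, a⟩
        · obtain ⟨a, b, c⟩ := key i12 i32 t₂ t₁ t₃ h₂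
          exact ⟨b, a, c⟩
      · exact key i21 i31 t₁ t₂ t₃ h₁
    obtain ⟨m₁, m₂, m₃⟩ := hA'Λ
    have hΛ : G '' fccStacking 1 (Real.sqrt (2 / 3)) = A' '' fccStacking 1 (Real.sqrt (2 / 3)) :=
      movedFcc_eq_of_three_independent_units G A' mG₁ mG₂ mG₃ m₁ m₂ m₃ (nG hv₁) (nG hv₂) (nG hv₃) hindG
    have hdz := image_fccSlots_eq_of_image_fcc_eq G A' hΛ
    have hA'm : IsTwinReading X A' m r := isTwinReading_transfer hdz hG
    exact Or.inr ⟨hdz, (twinDozen_normal_eq_self A' hA'read.1.1 hm1 hA'read.1.2 hA'm.1.2 hA'read.2.1 hA'm.2.2.2).symm⟩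

/-- **One ball, one twin plane**: a ball that is a twin reading of `(A, n)` and of `(G, m)` has `m = n` or `m = −n`. -/
theorem isTwinReading_normal_eq_or (hX : ∀ p ∈ X, ∀ q ∈ X, p ≠ q → 1 ≤ dist p q)
    (A G : EuclideanSpace ℝ (Fin 3) ≃ₗᵢ[ℝ] EuclideanSpace ℝ (Fin 3)) {n m r : EuclideanSpace ℝ (Fin 3)}
    (hA : IsTwinReading X A n r) (hG : IsTwinReading X G m r) : m = n ∨ m = -n := by
  rcases isTwinReading_rigid hX A G hA hG with ⟨-, h⟩ | ⟨-, h⟩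
  · exact Or.inl h
  · exact Or.inr h

/-! ## The relaunch letter -/

/-- **THE RELAUNCH LETTER.**  Root frame `F₀`, root slot `w` whose image crosses `n` upward (`⟪F₀ w, n⟫ = √(2/3)` — the mirror launch direction),
a unit letter `μ` with `⟪w, μ⟫ = √(2/3)` (well-formedness of the class `[μ]`); if the class-`[μ]` frame `M_μ ≫ F₀` reads the twin `(M_μ ≫ F₀, F₀ μ)` at a
ball `r` that is a twin reading of `(A, n)`, then `μ = F₀⁻¹ n`.  (The reading normal is `± n` by rigidity; `−n` contradicts `⟪F₀ w, F₀ μ⟫ = ⟪w, μ⟫ > 0`.) -/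
theorem relaunch_letter_eq (hX : ∀ p ∈ X, ∀ q ∈ X, p ≠ q → 1 ≤ dist p q)
    (A F₀ : EuclideanSpace ℝ (Fin 3) ≃ₗᵢ[ℝ] EuclideanSpace ℝ (Fin 3)) {n r w μ : EuclideanSpace ℝ (Fin 3)}
    (hr : IsTwinReading X A n r) (hwn : ⟪F₀ w, n⟫_ℝ = Real.sqrt (2 / 3)) (hwμ : ⟪w, μ⟫_ℝ = Real.sqrt (2 / 3))
    (hread : IsTwinReading X (((ℝ ∙ μ)ᗮ.reflection).trans F₀) (F₀ μ) r) : μ = F₀.symm n := by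
  have hs : 0 < Real.sqrt (2 / 3) := Real.sqrt_pos.2 (by norm_num)
  rcases isTwinReading_normal_eq_or hX A _ hr hread with h | h
  · rw [← h, LinearIsometryEquiv.symm_apply_apply]
  · exfalso
    have h1 : ⟪F₀ w, F₀ μ⟫_ℝ = Real.sqrt (2 / 3) := by rw [LinearIsometryEquiv.inner_map_map, hwμ]
    rw [h, inner_neg_right, hwn] at h1
    linarith

/-- **Letters other than `F₀⁻¹ n` never relaunch** (the contrapositive the cut census consumes). -/
theorem not_isTwinReading_of_letter_ne (hX : ∀ p ∈ X, ∀ q ∈ X, p ≠ q → 1 ≤ dist p q)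
    (A F₀ : EuclideanSpace ℝ (Fin 3) ≃ₗᵢ[ℝ] EuclideanSpace ℝ (Fin 3)) {n r w μ : EuclideanSpace ℝ (Fin 3)}
    (hr : IsTwinReading X A n r) (hwn : ⟪F₀ w, n⟫_ℝ = Real.sqrt (2 / 3)) (hwμ : ⟪w, μ⟫_ℝ = Real.sqrt (2 / 3)) (hne : μ ≠ F₀.symm n) :
    ¬ IsTwinReading X (((ℝ ∙ μ)ᗮ.reflection).trans F₀) (F₀ μ) r :=
  fun hread => hne (relaunch_letter_eq hX A F₀ hr hwn hwμ hread)

end Summit.Ventures.Crystal3D.Theorems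

end
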